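import Summits.Ventures.HSemireg.WedgeHankelRecurrenceGaussChebyshevCatalanVajda

/-!
# Venture HSemireg — **PARTIAL SUMS IN EVERY COMMUTATIVE RING: `(X − 2)·Σ_{k≤n} S_k = S_{n+1} − S_n − 1`, `(X − 2)·Σ_{k≤n} C_k = C_{n+1} − C_n + X − 2`, `(X + 2)·Σ_{k≤n} (−1)^k S_k = (−1)^n (S_{n+1} + S_n) + 1`,
# `(X + 2)·Σ_{k≤n} (−1)^k C_k = (−1)^n (C_{n+1} + C_n) + X + 2`** (telescoping `(X ∓ 2)P_k = P_{k+1} ∓ 2P_k + P_{k−1}`; at `x = 2cos θ` the sums `Σ sin((k+1)θ)` ∕ `Σ cos kθ` in closed form)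

HONEST FRAMING. Part of the Lean index of the computation cell `pub-hsemireg` (seat p10 gen 49, Sunday typer «UNIFORM-IN-n»).  Polynomial algebra over a commutative ring (Mathlib
`Polynomial.Chebyshev.S ∕ C`, `Finset.sum`); no variety, no cohomology theory, no sheaf, no Ext group and no semiregularity map is constructed here; nothing here says that HC / HC_CM / HC_AV holds;
no Literature fact (unproved `Prop`) is declared or used.  Custodian versions as in `WedgeHankelSiegelIdeal` (1/3).
SOURCES (cited).  J. C. Mason, D. C. Handscomb, *Chebyshev Polynomials* (2003), §2.4.3–2.4.4 (sums of Chebyshev polynomials); I. S. Gradshteyn, I. M. Ryzhik, *Table*, 1.341–1.342 (`Σ sin kx`, `Σ cos kx`,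
alternating sums); E. R. Hansen, *A Table of Series and Products* (1975), §17.
PROOF TYPED HERE.  Induction on `n` with `X·S_j = S_{j+1} + S_{j−1}` (N537 `X_mul_chebyshevS`) and `X·C_j = C_{j+1} + C_{j−1}` (Mathlib `C_add_two`), `Finset.sum_range_succ`, `pow_succ`; bases `S_0 = 1`,
`S_{−1} = 0`, `S_1 = X`, `C_0 = 2`, `C_1 = X`.
DEDUP DISCLOSURE (`rg -n '∑ .*Chebyshev.(S|C) R' Summits/Ventures/HSemireg` — only N537–N539 (Clebsch–Gordan, Dirichlet, Fejér sums), 2026-09-04): no plain or alternating partial sums `Σ S_k`, `Σ C_k` in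
Mathlib or the tree; 0 hits for the 5 names below.

WHAT IS IN THE TREE.  N537 `X_mul_chebyshevS`; Mathlib `C_add_two`, `S_zero ∕ S_one`, `C_zero ∕ C_one`, `Finset.sum_range_succ`.
THIS FILE (namespace `Summit.Ventures.HSemireg.Wedge.HankelOuter` continued; CHAINED on N544; 0 definitions):
* §1310 `X_mul_chebyshevC` (`X·C_j = C_{j+1} + C_{j−1}`), **`X_sub_two_mul_sum_chebyshevS`**, **`X_sub_two_mul_sum_chebyshevC`**, **`X_add_two_mul_alternating_sum_chebyshevS`**,
  **`X_add_two_mul_alternating_sum_chebyshevC`** (statements as in the title).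
CAVEATS.  `n ∈ ℕ`; sums over `Finset.range (n + 1)` with `ℤ`-cast indices.  Nothing Ext-side.  New names only.
-/

open Module Polynomial
open scoped Matrix Polynomial

namespace Summit.Ventures.HSemireg.Wedge.HankelOuter

/-! ## §1310. Partial sums of `S_k` and `C_k` -/

/-- `X·C_j = C_{j+1} + C_{j−1}` (the three-term recurrence, Mathlib `C_sub_one`). [this file, §1310] -/
theorem X_mul_chebyshevC (R : Type*) [CommRing R] (j : ℤ) :
    X * Polynomial.Chebyshev.C R j = Polynomial.Chebyshev.C R (j + 1) + Polynomial.Chebyshev.C R (j - 1) := by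
  have h := Polynomial.Chebyshev.C_sub_one R j
  linear_combination -h

/-- **`(X − 2)·Σ_{k≤n} S_k = S_{n+1} − S_n − 1`** in every commutative ring. [Mason–Handscomb 2003, §2.4.4; this file, §1310] -/
theorem X_sub_two_mul_sum_chebyshevS (R : Type*) [CommRing R] (n : ℕ) :
    (X - 2) * ∑ k ∈ Finset.range (n + 1), Polynomial.Chebyshev.S R (k : ℤ) = Polynomial.Chebyshev.S R ((n : ℤ) + 1) - Polynomial.Chebyshev.S R (n : ℤ) - 1 := by
  induction n with
  | zero => simp; ring
  | succ m ih =>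
    rw [Finset.sum_range_succ, mul_add, ih]
    have h := X_mul_chebyshevS R ((m : ℤ) + 1)
    rw [show (m : ℤ) + 1 - 1 = (m : ℤ) by ring] at h
    push_cast
    linear_combination h

/-- **`(X − 2)·Σ_{k≤n} C_k = C_{n+1} − C_n + X − 2`** in every commutative ring. [Mason–Handscomb 2003, §2.4.4; this file, §1310] -/
theorem X_sub_two_mul_sum_chebyshevC (R : Type*) [CommRing R] (n : ℕ) :
    (X - 2) * ∑ k ∈ Finset.range (n + 1), Polynomial.Chebyshev.C R (k : ℤ) = Polynomial.Chebyshev.C R ((n : ℤ) + 1) - Polynomial.Chebyshev.C R (n : ℤ) + X - 2 := by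
  induction n with
  | zero => simp; ring
  | succ m ih =>
    rw [Finset.sum_range_succ, mul_add, ih]
    have h := X_mul_chebyshevC R ((m : ℤ) + 1)
    rw [show (m : ℤ) + 1 - 1 = (m : ℤ) by ring] at h
    push_cast
    linear_combination h

/-- **`(X + 2)·Σ_{k≤n} (−1)^k S_k = (−1)^n (S_{n+1} + S_n) + 1`** in every commutative ring. [Gradshteyn–Ryzhik 1.342 (polynomial form); this file, §1310] -/
theorem X_add_two_mul_alternating_sum_chebyshevS (R : Type*) [CommRing R] (n : ℕ) :
    (X + 2) * ∑ k ∈ Finset.range (n + 1), (-1) ^ k * Polynomial.Chebyshev.S R (k : ℤ) =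
      (-1) ^ n * (Polynomial.Chebyshev.S R ((n : ℤ) + 1) + Polynomial.Chebyshev.S R (n : ℤ)) + 1 := by
  induction n with
  | zero => simp; ring
  | succ m ih =>
    rw [Finset.sum_range_succ, mul_add, ih]
    have h := X_mul_chebyshevS R ((m : ℤ) + 1)
    rw [show (m : ℤ) + 1 - 1 = (m : ℤ) by ring] at h
    push_cast
    rw [pow_succ]
    linear_combination (-(-1 : R[X]) ^ m) * h

/-- **`(X + 2)·Σ_{k≤n} (−1)^k C_k = (−1)^n (C_{n+1} + C_n) + X + 2`** in every commutative ring. [Gradshteyn–Ryzhik 1.342 (polynomial form); this file, §1310] -/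
theorem X_add_two_mul_alternating_sum_chebyshevC (R : Type*) [CommRing R] (n : ℕ) :
    (X + 2) * ∑ k ∈ Finset.range (n + 1), (-1) ^ k * Polynomial.Chebyshev.C R (k : ℤ) =
      (-1) ^ n * (Polynomial.Chebyshev.C R ((n : ℤ) + 1) + Polynomial.Chebyshev.C R (n : ℤ)) + X + 2 := by
  induction n with
  | zero => simp; ring
  | succ m ih =>
    rw [Finset.sum_range_succ, mul_add, ih]
    have h := X_mul_chebyshevC R ((m : ℤ) + 1)
    rw [show (m : ℤ) + 1 - 1 = (m : ℤ) by ring] at h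
    push_cast
    rw [pow_succ]
    linear_combination (-(-1 : R[X]) ^ m) * h

end Summit.Ventures.HSemireg.Wedge.HankelOuter
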